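import Summits.NavierStokesRegularity.NavierStokesRegularity.Theorems.TerminalTraceTypeITraceScarL3ExteriorIrrotationalSlice
import Summits.NavierStokesRegularity.NavierStokesRegularity.Theorems.TerminalTraceTypeITraceScarL3StubNoConfinedExtinctApex
import Literature.Analysis.FluidPDE.LocalTypeI
import HarnessLib

/-!
# C2 of the vorticity cut of Stub C (item `TerminalTrace.TypeITraceScarL3`, stmt-NavierStokesRegularity-18385):
# an extinct Type-I apex that is IRROTATIONAL on an exterior late region is CONFINED

Seat ns-typeII-p3 g9 (cell ns-regularity-ideate), `--supports stmt-NavierStokesRegularity-18385` (helper;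
nsreg-p2 ROUND-25 seed s25-6 «C ⇐ C1 ∧ C2 with C2 closable»).  After Stubs 1, 2′, B the item is, by
name, the statement of Stub C `stub_no_spreadExtinctApex` (`typeITraceScarL3_of_no_spreadExtinctApex`,
p585751): a SPREAD extinct Type-I apex is not backward singular.  The planner's cut: C1 «every extinct
Type-I apex is irrotational on some exterior late region ]−δ,−ε[ × (closedBall 0 R)ᶜ (uniformly in ε)»
— the ESS conclusion in the regime where the ESS hypothesis fails — and C2 «irrotational there ⇒
CONFINED», which with Stub B (p585263) kills the apex.  This file closes C2 and records «Stub C ⇐ C1»: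

(The slice estimate `norm_le_of_irrotational_exterior_slice` — harmonic coordinates, interior mean
value bound, `A`-part — is in `TerminalTraceTypeITraceScarL3ExteriorIrrotationalSlice.lean`, p-id in
the seat's KIT-INDEX.)
* `confined_of_exterior_irrotational` — **C2**: under the Albritton–Barker bound `𝐈(Q(a)) ≤ M` at every
  scale (only its `A`-part is used), if for every `ε ∈ ]0, δ[` the field `U` agrees a.e. on
  `]−δ,−ε[ × (closedBall 0 R)ᶜ` with a field whose slices are `C²`, irrotational and incompressible on
  `(closedBall 0 R)ᶜ`, then `U` is essentially bounded on `]−δ, 0[ × (closedBall 0 (4R))ᶜ` — the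
  confinement clause of Stub B, verbatim.  (Interface «T2», classical on sub-slabs: the form a C1-proof
  in the ESS architecture delivers, the rate `C/√(−s)` making `U` bounded, hence smooth, on every
  `]−δ,−ε[ × ℝ³`.)
* `no_extinctApex_of_exterior_irrotational` — C2 composed with Stub B: an extinct Type-I apex (the six
  registered clauses) which is irrotational on an exterior late region in the above sense is NOT backward
  singular at the origin.
* `no_spreadExtinctApex_of_C1` — the kernel record «Stub C ⇐ C1»: if every extinct Type-I apex that is
  spread is irrotational on some exterior late region (C1, OPEN — the NS-specific exterior backward
  uniqueness question of seed s25-3), then the statement of `stub_no_spreadExtinctApex` holds.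

WHAT THIS IS NOT: not Stub C, not C1, not NS regularity — C2 and two by-name compositions; C1 is OPEN.
[folklore; EscauriazaSereginSverak2003 §3; Seregin2014 §6.6; GilbargTrudinger2001 Thm 2.1; KNSS2009 Lemma 3.1]
-/

noncomputable section

set_option linter.dupNamespace false

namespace Summit.NavierStokesRegularity.NavierStokesRegularity.Theorems.TypeITraceScarL3

open MeasureTheory Set Function Filter Topology Metric InnerProductSpace
open Literature.Analysis.FluidPDE
open scoped NNReal ENNReal RealInnerProductSpace Laplacian ContDiff

/-! ### C2: exterior-irrotational ⇒ confined -/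

/-- **C2 of the vorticity cut: an extinct Type-I apex which is irrotational on an exterior late region
is CONFINED.**  Let `U` carry the Albritton–Barker bound `𝐈(Q(a)) ≤ M` at every scale (only the
`A`-part `sup_s a⁻¹ ∫_{B_a} |U(s)|² ≤ M` is used).  Suppose that for every `ε ∈ ]0, δ[` there is a field
`V` agreeing with `U` a.e. on `]−δ,−ε[ × (closedBall 0 R)ᶜ` whose slices `V(s, ·)`, `s ∈ ]−δ,−ε[`, are
`C²` on `(closedBall 0 R)ᶜ` with `curl V(s,·) = 0` and `div V(s,·) = 0` there.  Then `U` is essentially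
bounded on the exterior backward slab `]−δ, 0[ × (closedBall 0 (4R))ᶜ` (the confinement clause of
Stub B `stub_no_confinedExtinctApex`).  Proof: div-free and curl-free slices are harmonic on the
exterior region; the interior mean value bound on `B(x, ‖x‖/2)` and the `A`-part give
`‖V(s, x)‖ ≤ K` for `‖x‖ > 4R` at a.e. time (`norm_le_of_irrotational_exterior_slice`), uniformly in
`ε`; glue over `s` (Fubini) and over `ε = δ/(k+2)`. [folklore; EscauriazaSereginSverak2003 §3;
GilbargTrudinger2001 Thm 2.1] -/
theorem confined_of_exterior_irrotational
    {U : ℝ → EuclideanSpace ℝ (Fin 3) → EuclideanSpace ℝ (Fin 3)}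
    {P : ℝ → EuclideanSpace ℝ (Fin 3) → ℝ}
    {G : ℝ → EuclideanSpace ℝ (Fin 3) → EuclideanSpace ℝ (Fin 3) →L[ℝ] EuclideanSpace ℝ (Fin 3)}
    {M : ℝ≥0}
    (hI : ∀ a : ℝ, 0 < a →
      typeIBound (parabolicCylinder a (0 : ℝ × EuclideanSpace ℝ (Fin 3))) U P G ≤ M)
    {δ R : ℝ} (hδ : 0 < δ) (hR : 0 < R)
    (hirr : ∀ ε : ℝ, 0 < ε → ε < δ →
      ∃ V : ℝ → EuclideanSpace ℝ (Fin 3) → EuclideanSpace ℝ (Fin 3),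
        uncurry V =ᵐ[volume.restrict
          (Ioo (-δ) (-ε) ×ˢ (closedBall (0 : EuclideanSpace ℝ (Fin 3)) R)ᶜ)] uncurry U ∧
        ∀ s ∈ Ioo (-δ) (-ε),
          ContDiffOn ℝ 2 (V s) (closedBall (0 : EuclideanSpace ℝ (Fin 3)) R)ᶜ ∧
          ∀ x ∈ (closedBall (0 : EuclideanSpace ℝ (Fin 3)) R)ᶜ,
            curl (V s) x = 0 ∧ VectorCalculus.divergence (V s) x = 0) :
    ∃ δ' : ℝ, 0 < δ' ∧ ∃ R' K : ℝ, ∀ᵐ z ∂(volume.restrict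
      (Ioo (-δ') 0 ×ˢ (closedBall (0 : EuclideanSpace ℝ (Fin 3)) R')ᶜ)), ‖U z.1 z.2‖ ≤ K := by
  -- ### constants
  obtain ⟨C, hC0, hC⟩ := exists_const_abs_le_integral_ball_of_harmonicOn
  set n₀ : ℕ := ⌈δ⌉₊ + 1 with hn₀def
  have hn₀ : 1 ≤ n₀ := by rw [hn₀def]; exact Nat.le_add_left 1 _
  have hn₀r : (n₀ : ℝ) = ⌈δ⌉₊ + 1 := by rw [hn₀def]; push_cast; ring
  have hn₀δ : δ ≤ (n₀ : ℝ) ^ 2 := by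
    have h1 : δ ≤ ⌈δ⌉₊ := Nat.le_ceil δ
    have h2 : (0 : ℝ) ≤ ⌈δ⌉₊ := Nat.cast_nonneg _
    rw [hn₀r]; nlinarith
  set K : ℝ := C * ((volume (ball (0 : EuclideanSpace ℝ (Fin 3)) 1)).toReal / (4 * R ^ 2) + 3 * M +
      M * (n₀ + 1) / (2 * R)) with hKdef
  set S₄ : Set (EuclideanSpace ℝ (Fin 3)) := (closedBall (0 : EuclideanSpace ℝ (Fin 3)) (4 * R))ᶜ
    with hS₄def
  have hS₄m : MeasurableSet S₄ := measurableSet_closedBall.compl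
  have hS₄S : S₄ ⊆ (closedBall (0 : EuclideanSpace ℝ (Fin 3)) R)ᶜ :=
    compl_subset_compl.2 (closedBall_subset_closedBall (by linarith))
  refine ⟨δ, hδ, 4 * R, K, ?_⟩
  -- ### the `A`-part: for a.e. `s ∈ ]-δ, 0[`, `∫_{B(0, n+n₀)} |U(s)|² ≤ M (n + n₀)` for all `n : ℕ`
  have hA : ∀ᵐ s ∂(volume.restrict (Ioo (-δ) 0)), ∀ n : ℕ,
      ∫⁻ y in ball (0 : EuclideanSpace ℝ (Fin 3)) ((n : ℝ) + n₀), ‖U s y‖ₑ ^ 2 ≤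
        (M : ℝ≥0∞) * ENNReal.ofReal ((n : ℝ) + n₀) := by
    refine ae_all_iff.2 fun n => ?_
    have hn₀' : (1 : ℝ) ≤ n₀ := by exact_mod_cast hn₀
    have hρ0 : (0 : ℝ) < n + n₀ := by positivity
    have hAe : cknAEss ((n : ℝ) + n₀) (0 : ℝ × EuclideanSpace ℝ (Fin 3)) U ≤ M :=
      (cknAEss_le_abScaledSum (p := P) (G := G)).trans
        ((abScaledSum_le_typeIBound hρ0 subset_rfl).trans (hI _ hρ0))
    have h1 : ∀ᵐ t ∂(volume.restrict (Ioo ((0 : ℝ × EuclideanSpace ℝ (Fin 3)).1 - ((n : ℝ) + n₀) ^ 2)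
        (0 : ℝ × EuclideanSpace ℝ (Fin 3)).1)),
        (ENNReal.ofReal ((n : ℝ) + n₀))⁻¹ *
          ∫⁻ y in ball (0 : ℝ × EuclideanSpace ℝ (Fin 3)).2 ((n : ℝ) + n₀), ‖U t y‖ₑ ^ 2 ≤ M := by
      have h := ENNReal.ae_le_essSup (μ := volume.restrict (Ioo ((0 : ℝ × EuclideanSpace ℝ (Fin 3)).1 -
          ((n : ℝ) + n₀) ^ 2) (0 : ℝ × EuclideanSpace ℝ (Fin 3)).1))
        (fun t => (ENNReal.ofReal ((n : ℝ) + n₀))⁻¹ *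
          ∫⁻ y in ball (0 : ℝ × EuclideanSpace ℝ (Fin 3)).2 ((n : ℝ) + n₀), ‖U t y‖ₑ ^ 2)
      filter_upwards [h] with t ht
      exact ht.trans hAe
    have hsub : Ioo (-δ) 0 ⊆ Ioo ((0 : ℝ × EuclideanSpace ℝ (Fin 3)).1 - ((n : ℝ) + n₀) ^ 2)
        (0 : ℝ × EuclideanSpace ℝ (Fin 3)).1 := by
      intro t ht
      simp only [Prod.fst_zero, zero_sub, mem_Ioo]
      have hn0 : (0 : ℝ) ≤ n := Nat.cast_nonneg _
      have : δ ≤ ((n : ℝ) + n₀) ^ 2 := hn₀δ.trans (by nlinarith)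
      exact ⟨by linarith [ht.1], ht.2⟩
    filter_upwards [ae_restrict_of_ae_restrict_of_subset hsub h1] with t ht
    rw [Prod.snd_zero] at ht
    have hne0 : ENNReal.ofReal ((n : ℝ) + n₀) ≠ 0 := (ENNReal.ofReal_pos.2 hρ0).ne'
    calc ∫⁻ y in ball (0 : EuclideanSpace ℝ (Fin 3)) ((n : ℝ) + n₀), ‖U t y‖ₑ ^ 2
        = ENNReal.ofReal ((n : ℝ) + n₀) * ((ENNReal.ofReal ((n : ℝ) + n₀))⁻¹ *
            ∫⁻ y in ball (0 : EuclideanSpace ℝ (Fin 3)) ((n : ℝ) + n₀), ‖U t y‖ₑ ^ 2) := by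
          rw [← mul_assoc, ENNReal.mul_inv_cancel hne0 ENNReal.ofReal_ne_top, one_mul]
      _ ≤ ENNReal.ofReal ((n : ℝ) + n₀) * M := mul_le_mul_right ht _
      _ = (M : ℝ≥0∞) * ENNReal.ofReal ((n : ℝ) + n₀) := mul_comm _ _
  -- ### the bound on each sub-slab `]-δ, -ε[ × S₄`
  have hslab : ∀ ε : ℝ, 0 < ε → ε < δ →
      ∀ᵐ z ∂(volume.restrict (Ioo (-δ) (-ε) ×ˢ S₄)), ‖U z.1 z.2‖ ≤ K := by
    intro ε hε hεδ
    obtain ⟨V, hVU, hVreg⟩ := hirr ε hε hεδ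
    set I : Set ℝ := Ioo (-δ) (-ε) with hIdef
    have hIm : MeasurableSet I := measurableSet_Ioo
    have hIsub : I ⊆ Ioo (-δ) 0 := Ioo_subset_Ioo_right (by linarith)
    -- slices: for a.e. `s ∈ I`, `V s = U s` a.e. on the exterior region
    have hsliceVU : ∀ᵐ s ∂(volume.restrict I),
        ∀ᵐ y ∂(volume.restrict (closedBall (0 : EuclideanSpace ℝ (Fin 3)) R)ᶜ), V s y = U s y := by
      have h1 : ∀ᵐ z ∂((volume.restrict I).prod
          (volume.restrict (closedBall (0 : EuclideanSpace ℝ (Fin 3)) R)ᶜ)),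
          uncurry V z = uncurry U z := by
        rw [Measure.prod_restrict, ← Measure.volume_eq_prod]; exact hVU
      filter_upwards [Measure.ae_ae_of_ae_prod h1] with s hs
      filter_upwards [hs] with y hy
      exact hy
    -- the pointwise bound for `V` at a.e. time
    have hgood : ∀ᵐ s ∂(volume.restrict I), ∀ x ∈ S₄, ‖V s x‖ ≤ K := by
      filter_upwards [ae_restrict_mem hIm, hsliceVU,
        ae_restrict_of_ae_restrict_of_subset hIsub hA] with s hs hVUs hAs
      intro x hx
      have hx' : 4 * R < ‖x‖ := by
        rw [hS₄def, mem_compl_iff, mem_closedBall_zero_iff, not_le] at hx; exact hx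
      obtain ⟨hVs, hcd⟩ := hVreg s hs
      have h := norm_le_of_irrotational_exterior_slice hC0 hC hR hVs hcd hVUs hn₀ hAs hx'
      rw [hKdef]; exact h
    -- from the slices to the product, for `V`
    have hprodV : ∀ᵐ z ∂(volume.restrict (I ×ˢ S₄)), ‖V z.1 z.2‖ ≤ K := by
      have hbad : volume.restrict I {s | ¬ ∀ x ∈ S₄, ‖V s x‖ ≤ K} = 0 := ae_iff.1 hgood
      obtain ⟨N, hNsub, hNm, hN0⟩ := exists_measurable_superset_of_null hbad
      have hprod0 : volume.restrict (I ×ˢ S₄) (N ×ˢ (univ : Set (EuclideanSpace ℝ (Fin 3)))) = 0 := by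
        rw [Measure.volume_eq_prod, ← Measure.prod_restrict, Measure.prod_prod, hN0, zero_mul]
      have hae : ∀ᵐ z ∂(volume.restrict (I ×ˢ S₄)),
          z ∉ N ×ˢ (univ : Set (EuclideanSpace ℝ (Fin 3))) :=
        measure_eq_zero_iff_ae_notMem.1 hprod0
      filter_upwards [hae, ae_restrict_mem (hIm.prod hS₄m)] with z hz hzmem
      have hz1 : z.1 ∉ N := fun h => hz ⟨h, mem_univ _⟩
      have hz1' : ∀ x ∈ S₄, ‖V z.1 x‖ ≤ K := by
        by_contra hcon
        exact hz1 (hNsub hcon)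
      exact hz1' z.2 hzmem.2
    -- transfer to `U`
    have hVU' : ∀ᵐ z ∂(volume.restrict (I ×ˢ S₄)), uncurry V z = uncurry U z :=
      ae_restrict_of_ae_restrict_of_subset (prod_mono Subset.rfl hS₄S) hVU
    filter_upwards [hprodV, hVU'] with z hz hzVU
    have : V z.1 z.2 = U z.1 z.2 := hzVU
    rw [← this]; exact hz
  -- ### union over `ε = δ/(k+2)`
  have hunion : Ioo (-δ) 0 ×ˢ S₄ = ⋃ k : ℕ, Ioo (-δ) (-(δ / ((k : ℝ) + 2))) ×ˢ S₄ := by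
    rw [← iUnion_prod_const]
    congr 1
    ext s
    simp only [mem_Ioo, mem_iUnion]
    constructor
    · rintro ⟨h1, h2⟩
      have hs : 0 < -s := by linarith
      obtain ⟨k, hk⟩ := exists_nat_gt (δ / (-s))
      refine ⟨k, h1, ?_⟩
      have hk' : δ < ((k : ℝ) + 2) * (-s) := by
        rw [div_lt_iff₀ hs] at hk; nlinarith
      have : δ / ((k : ℝ) + 2) < -s := by
        rw [div_lt_iff₀ (by positivity)]; linarith
      linarith
    · rintro ⟨k, h1, h2⟩
      have : 0 < δ / ((k : ℝ) + 2) := by positivity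
      exact ⟨h1, by linarith⟩
  rw [hunion]
  refine (ae_restrict_iUnion_iff _ _).2 fun k => hslab (δ / ((k : ℝ) + 2)) (by positivity) ?_
  have hk2 : (1 : ℝ) < (k : ℝ) + 2 := by
    have : (0 : ℝ) ≤ k := Nat.cast_nonneg _
    linarith
  exact div_lt_self hδ hk2

/-! ### Compositions: C2 + Stub B, and «Stub C ⇐ C1» -/

/-- **An extinct Type-I apex which is irrotational on an exterior late region is not singular at the
origin** (C2 `confined_of_exterior_irrotational` composed with Stub B `stub_no_confinedExtinctApex`,
p585263).  The six clauses are the registered apex package of line `apex-dichotomy`; the seventh is the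
exterior-irrotational representative on the sub-slabs `]−δ,−ε[ × (closedBall 0 R)ᶜ`.
[folklore; EscauriazaSereginSverak2003 Thm 5.1; Seregin2014 §6.6] -/
theorem no_extinctApex_of_exterior_irrotational
    {U : ℝ → EuclideanSpace ℝ (Fin 3) → EuclideanSpace ℝ (Fin 3)}
    {P : ℝ → EuclideanSpace ℝ (Fin 3) → ℝ}
    {G : ℝ → EuclideanSpace ℝ (Fin 3) → EuclideanSpace ℝ (Fin 3) →L[ℝ] EuclideanSpace ℝ (Fin 3)}
    {M D₀ : ℝ≥0} {C : ℝ}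
    (hsw : ∀ a : ℝ, 0 < a →
      IsSuitableWeakSolutionInBall a (0 : ℝ × EuclideanSpace ℝ (Fin 3)) U P)
    (hG : ∀ a : ℝ, 0 < a →
      HasWeakSpatialGradientOn
        (parabolicCylinderOpens a (0 : ℝ × EuclideanSpace ℝ (Fin 3))) U G)
    (hI : ∀ a : ℝ, 0 < a →
      typeIBound (parabolicCylinder a (0 : ℝ × EuclideanSpace ℝ (Fin 3))) U P G ≤ M)
    (hD : ∀ z₀ : ℝ × EuclideanSpace ℝ (Fin 3), z₀.1 ≤ 0 → ∀ r : ℝ, 0 < r → cknD r z₀ P ≤ D₀)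
    (hrate : ∀ s : ℝ, s < 0 →
      ∀ᵐ y : EuclideanSpace ℝ (Fin 3), ‖U s y‖ ≤ C / Real.sqrt (-s))
    (htop : ∀ φ : EuclideanSpace ℝ (Fin 3) → EuclideanSpace ℝ (Fin 3), ContDiff ℝ (⊤ : ℕ∞) φ →
      HasCompactSupport φ → ∀ ε : ℝ, 0 < ε →
        ∃ s₀ : ℝ, s₀ < 0 ∧ ∀ᵐ s ∂(volume.restrict (Ioo s₀ 0)), |∫ y, ⟪U s y, φ y⟫| ≤ ε)
    {δ R : ℝ} (hδ : 0 < δ) (hR : 0 < R)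
    (hirr : ∀ ε : ℝ, 0 < ε → ε < δ →
      ∃ V : ℝ → EuclideanSpace ℝ (Fin 3) → EuclideanSpace ℝ (Fin 3),
        uncurry V =ᵐ[volume.restrict
          (Ioo (-δ) (-ε) ×ˢ (closedBall (0 : EuclideanSpace ℝ (Fin 3)) R)ᶜ)] uncurry U ∧
        ∀ s ∈ Ioo (-δ) (-ε),
          ContDiffOn ℝ 2 (V s) (closedBall (0 : EuclideanSpace ℝ (Fin 3)) R)ᶜ ∧
          ∀ x ∈ (closedBall (0 : EuclideanSpace ℝ (Fin 3)) R)ᶜ,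
            curl (V s) x = 0 ∧ VectorCalculus.divergence (V s) x = 0) :
    ¬ IsBackwardSingularPoint U (0 : ℝ × EuclideanSpace ℝ (Fin 3)) :=
  stub_no_confinedExtinctApex U P G M D₀ C hsw hG hI hD hrate htop
    (confined_of_exterior_irrotational hI hδ hR hirr)

/-- **«Stub C ⇐ C1»** (the vorticity cut of nsreg-p2 ROUND-25, seed s25-6, in the kernel).  If C1 holds
— every extinct Type-I apex (the registered six-clause package) which is SPREAD (not essentially
bounded in any exterior backward slab) admits, for some `δ, R > 0` and every `ε ∈ ]0, δ[`, a
representative on `]−δ,−ε[ × (closedBall 0 R)ᶜ` with `C²`, irrotational, incompressible slices — then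
the statement of Stub C `stub_no_spreadExtinctApex` holds (indeed C1's conclusion contradicts
spreadness by C2, so such apices do not exist).  C1 is OPEN: it is the NS-specific exterior backward
uniqueness question with Type-I coefficients (seed s25-3). [folklore; EscauriazaSereginSverak2003 §3–§5;
Seregin2014 §6.6] -/
theorem no_spreadExtinctApex_of_C1
    (hC1 : ∀ (U : ℝ → EuclideanSpace ℝ (Fin 3) → EuclideanSpace ℝ (Fin 3))
      (P : ℝ → EuclideanSpace ℝ (Fin 3) → ℝ)
      (G : ℝ → EuclideanSpace ℝ (Fin 3) →
        EuclideanSpace ℝ (Fin 3) →L[ℝ] EuclideanSpace ℝ (Fin 3))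
      (M D₀ : ℝ≥0) (C : ℝ),
      (∀ a : ℝ, 0 < a →
        IsSuitableWeakSolutionInBall a (0 : ℝ × EuclideanSpace ℝ (Fin 3)) U P) →
      (∀ a : ℝ, 0 < a →
        HasWeakSpatialGradientOn
          (parabolicCylinderOpens a (0 : ℝ × EuclideanSpace ℝ (Fin 3))) U G) →
      (∀ a : ℝ, 0 < a →
        typeIBound (parabolicCylinder a (0 : ℝ × EuclideanSpace ℝ (Fin 3))) U P G ≤ M) →
      (∀ z₀ : ℝ × EuclideanSpace ℝ (Fin 3), z₀.1 ≤ 0 →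
        ∀ r : ℝ, 0 < r → cknD r z₀ P ≤ D₀) →
      (∀ s : ℝ, s < 0 →
        ∀ᵐ y : EuclideanSpace ℝ (Fin 3), ‖U s y‖ ≤ C / Real.sqrt (-s)) →
      (∀ φ : EuclideanSpace ℝ (Fin 3) → EuclideanSpace ℝ (Fin 3),
        ContDiff ℝ (⊤ : ℕ∞) φ →
        HasCompactSupport φ → ∀ ε : ℝ, 0 < ε →
        ∃ s₀ : ℝ, s₀ < 0 ∧ ∀ᵐ s ∂(volume.restrict (Ioo s₀ 0)), |∫ y, ⟪U s y, φ y⟫| ≤ ε) →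
      (∀ δ : ℝ, 0 < δ → ∀ R K : ℝ,
        ¬ (∀ᵐ z ∂(volume.restrict
          (Ioo (-δ) 0 ×ˢ (closedBall (0 : EuclideanSpace ℝ (Fin 3)) R)ᶜ)), ‖U z.1 z.2‖ ≤ K)) →
      ∃ δ : ℝ, 0 < δ ∧ ∃ R : ℝ, 0 < R ∧ ∀ ε : ℝ, 0 < ε → ε < δ →
        ∃ V : ℝ → EuclideanSpace ℝ (Fin 3) → EuclideanSpace ℝ (Fin 3),
          uncurry V =ᵐ[volume.restrict
            (Ioo (-δ) (-ε) ×ˢ (closedBall (0 : EuclideanSpace ℝ (Fin 3)) R)ᶜ)] uncurry U ∧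
          ∀ s ∈ Ioo (-δ) (-ε),
            ContDiffOn ℝ 2 (V s) (closedBall (0 : EuclideanSpace ℝ (Fin 3)) R)ᶜ ∧
            ∀ x ∈ (closedBall (0 : EuclideanSpace ℝ (Fin 3)) R)ᶜ,
              curl (V s) x = 0 ∧ VectorCalculus.divergence (V s) x = 0) :
    ∀ (U : ℝ → EuclideanSpace ℝ (Fin 3) → EuclideanSpace ℝ (Fin 3))
      (P : ℝ → EuclideanSpace ℝ (Fin 3) → ℝ)
      (G : ℝ → EuclideanSpace ℝ (Fin 3) →
        EuclideanSpace ℝ (Fin 3) →L[ℝ] EuclideanSpace ℝ (Fin 3))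
      (M D₀ : ℝ≥0) (C : ℝ),
      (∀ a : ℝ, 0 < a →
        IsSuitableWeakSolutionInBall a (0 : ℝ × EuclideanSpace ℝ (Fin 3)) U P) →
      (∀ a : ℝ, 0 < a →
        HasWeakSpatialGradientOn
          (parabolicCylinderOpens a (0 : ℝ × EuclideanSpace ℝ (Fin 3))) U G) →
      (∀ a : ℝ, 0 < a →
        typeIBound (parabolicCylinder a (0 : ℝ × EuclideanSpace ℝ (Fin 3))) U P G ≤ M) →
      (∀ z₀ : ℝ × EuclideanSpace ℝ (Fin 3), z₀.1 ≤ 0 →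
        ∀ r : ℝ, 0 < r → cknD r z₀ P ≤ D₀) →
      (∀ s : ℝ, s < 0 →
        ∀ᵐ y : EuclideanSpace ℝ (Fin 3), ‖U s y‖ ≤ C / Real.sqrt (-s)) →
      (∀ φ : EuclideanSpace ℝ (Fin 3) → EuclideanSpace ℝ (Fin 3),
        ContDiff ℝ (⊤ : ℕ∞) φ →
        HasCompactSupport φ → ∀ ε : ℝ, 0 < ε →
        ∃ s₀ : ℝ, s₀ < 0 ∧ ∀ᵐ s ∂(volume.restrict (Ioo s₀ 0)), |∫ y, ⟪U s y, φ y⟫| ≤ ε) →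
      (∀ δ : ℝ, 0 < δ → ∀ R K : ℝ,
        ¬ (∀ᵐ z ∂(volume.restrict
          (Ioo (-δ) 0 ×ˢ (closedBall (0 : EuclideanSpace ℝ (Fin 3)) R)ᶜ)), ‖U z.1 z.2‖ ≤ K)) →
      ¬ IsBackwardSingularPoint U (0 : ℝ × EuclideanSpace ℝ (Fin 3)) := by
  intro U P G M D₀ C hsw hG hI hD hrate htop hspread _hsing
  obtain ⟨δ, hδ, R, hR, hirr⟩ := hC1 U P G M D₀ C hsw hG hI hD hrate htop hspread
  obtain ⟨δ', hδ', R', K, hconf⟩ := confined_of_exterior_irrotational hI hδ hR hirr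
  exact hspread δ' hδ' R' K hconf

end Summit.NavierStokesRegularity.NavierStokesRegularity.Theorems.TypeITraceScarL3

end
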